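import Summits.HodgeConjecture.HodgeConjecture.Theses.HodgeProjectorDivisorSupport

/-!
# Birth skeleton (BC3) of the crux `HodgeProjectorDivisorSupported` (item stmt-HodgeConjecture-18704),
# route `HodgeProjectorDivisorSupport` — line `birth`

The crux W3 (cycle form): for `X` smooth projective of dimension `2n ≥ 2` and any resolution family `ρ`
of `X × X` in dimension `2n`, IF some ALGEBRAIC class `π ∈ N^{2n}H^{4n}((X × X)(ℂ); ℂ)` acts (through
`corrAction complexOrientationFamily`) on `H^{2n}(X(ℂ); ℂ)` as the orthogonal Hodge projector (identity on
the rational `(n,n)`-classes, zero on their cup-orthogonal), THEN a proper Zariski-closed `D ⊊ X`, two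
`2n`-cycles `Z'` (first projections of its points in `D`) and `Z''` (second projections in `D`) on `X × X`
and `u ≠ 0` exist with `[Z' + Z'']_*` acting as `u •` (that projector).

This file cuts the crux along the route's declared TWO-LAYER PLAN
("W3 ⇐ ProjectorCycle → CrossDecomposition → W3"), with the projector-cycle step itself cut at the one
place where a KNOWN theorem ends and a descent argument begins. Three registered stubs, `sorry` ONLY
inside `stub_*`, and the kernel-checked composition `HodgeProjectorDivisorSupported_of` concluding the
route decl BY NAME:

* `stub_algebraicClasses_le_span_cycleClass` (K, KNOWN theorem, not in the tree; size L) — PURITY of the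
  coniveau filtration in degree `2e` (Fulton, *Intersection Theory* §19.1, eq. (1) and Lemma 19.1.1;
  Voisin I §11.1.2–11.1.4): on a smooth projective `X` of dimension `d + e`, the space of algebraic classes
  `Nᵉ H^{2e}(X(ℂ); ℂ) = algebraicClasses X e` (the sum of the kernels of the restrictions to complements
  of codimension-`≥ e` Zariski-closed subsets — the tree's DEFINITION) is contained in the `ℂ`-span of
  the cycle classes `cycleClass complexOrientationFamily hX hde ρ Z`, `Z ∈ Z_d(X)` (the classes
  `Σ nᵢ τᵢ_* 1` through desingularisations, Voisin I §11.1.4 — the tree's real `cycleClass`): the kernel of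
  `H^{2e}(X) → H^{2e}(X ∖ S)` is the image of `H^{2e}_S(X) ≅ H^{BM}_{2d}(S(ℂ))`, which has basis the
  fundamental classes of the `d`-dimensional components of `S`, and their images are the cycle classes.
  The reverse inclusion is the tree's theorem `cycleClass_mem_algebraicClasses`.
* `stub_integralProjectorCycle` (D, ℚ-DESCENT; size M) — if a `ℂ`-combination `π` of cycle classes of
  `2n`-cycles on `X × X` acts as the orthogonal Hodge projector, then the class of one INTEGRAL `2n`-cycle
  `Z` acts as `u •` (that projector) for some `u ≠ 0`: the operators `[Zᵢ]_*` are `ℚ`-rational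
  (`isRationalClass_complexGysin_complexOrientationFamily`, rationality of pull-backs and cup products),
  both defining conditions are `ℚ`-linear in the coefficient vector once read on `ℚ`-bases of
  `Hdg^n(X)_ℚ` and of `(Hdg^n)^⊥ ∩ H^{2n}(X; ℚ)` (a `ℚ`-form of the cup-orthogonal), so the solution space
  `{(a, λ) : Σ aᵢ[Zᵢ]_* = λ on Hdg, = 0 on Hdg^⊥}` is defined over `ℚ` and contains a point with `λ = 1`;
  hence a rational point with `λ ≠ 0`; clear denominators.
* `stub_crossDecomposition` (H, the HEART, open; HC-implied) — an integral `2n`-cycle `Z` on `X × X`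
  whose class acts on `H^{2n}(X(ℂ); ℂ)` as `u •` (orthogonal Hodge projector), `u ≠ 0`, is, as a
  correspondence in degree `2n` and up to a positive multiple `m`, a CROSS-SUPPORTED cycle:
  `[Z' + Z'']_* = m • [Z]_*` on `H^{2n}(X(ℂ); ℂ)` with `Z'` over `D × X`, `Z''` over `X × D`, `D ⊊ X`
  proper closed (a two-sided Bloch–Srinivas decomposition OF THE PROJECTOR, homological and in the middle
  degree only — never a `CH₀`-nullity statement: the dead line `ch0-null-correspondence-support` of
  `MiddleDivisorSupport` died exactly at `CH₀`). Under HC: `Z' = Σ (m u gⁱʲ)[Zᵢ × Zⱼ]`, `Z'' = 0`,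
  `D = ⋃ supp Zᵢ` (Hodge–Riemann makes the Gram matrix of a `ℚ`-basis `[Zᵢ]` of `Hdg^n` invertible and
  `u ∈ ℚ`). Known unconditionally where End/Lefschetz correspondences span the Hodge classes (abelian
  varieties of Weil type with algebraic Weil classes, divisorial sectors); the route's bet is a spreading
  argument for the vanishing of `[Z]_*` on `(Hdg^n)^⊥ ⊇ H^{2n,0}` that needs no `CH₀` hypothesis.
* `HodgeProjectorDivisorSupported_of` (no `sorry`): K puts the W2-witness `π` in the span of cycle
  classes, D replaces it by an integral cycle `Z` acting as `u • P`, H decomposes `Z`, and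
  `u' := m · u ≠ 0`.

Sources: [BlochSrinivas1983, Prop. 1, Thm. 1]; [VoisinHodgeII2003, Thm. 10.19, Cor. 10.20, (10.7)–(10.9),
Lemma 9.18]; [VoisinHodgeI2002, §11.1.2–11.1.4]; [Fulton1998, §19.1 Lemma 19.1.1–19.1.2];
[Voisin2025, §5.2–5.3]; [Kleiman1968]; [Andre1996Motifs, §2.1]; [Markman2025, arXiv:2502.03415].
-/

set_option linter.dupNamespace false

namespace Summit.HodgeConjecture.HodgeConjecture.Cruxes.HodgeProjectorDivisorSupported.Birth

open CategoryTheory MonoidalCategory CartesianMonoidalCategory AlgebraicGeometry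
open Literature.AlgebraicGeometry.Motives Literature.AlgebraicGeometry.HodgeTheory
open Literature.AlgebraicTopology.SingularHomology

/-! ## §1 The stubs (the ONLY `sorry`s of this file) -/

/-- **STUB K — purity: algebraic classes are spanned by cycle classes** (KNOWN; Fulton §19.1 eq. (1),
Lemma 19.1.1; Voisin I §11.1.2–11.1.4). For `X` smooth projective of dimension `n = d + e` and every
resolution family `ρ` in dimension `d`,
`Nᵉ H^{2e}(X(ℂ); ℂ) ⊆ span_ℂ {cycleClass complexOrientationFamily hX hde ρ Z | Z ∈ Z_d(X)}`.
[Fulton1998 §19.1; VoisinHodgeI2002 §11.1.4; GrothendieckTopology1969 §1] -/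
theorem stub_algebraicClasses_le_span_cycleClass :
    ∀ ⦃n d e : ℕ⦄ ⦃X : SchemeOver ℂ⦄ (hX : IsSmoothProjective n X) (hde : d + e = n)
      (ρ : ResolutionFamily X d),
      algebraicClasses X e ≤
        Submodule.span ℂ (Set.range (cycleClass complexOrientationFamily hX hde ρ)) := by
  sorry

/-- **STUB D — ℚ-descent to an integral projector cycle.** For `X` smooth projective of dimension
`2n ≥ 2` and a resolution family `ρ` of `X × X` in dimension `2n`: if a `ℂ`-linear combination `π` of
cycle classes of `2n`-cycles on `X × X` acts on `H^{2n}(X(ℂ); ℂ)` as the orthogonal Hodge projector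
(identity on rational `(n,n)`-classes, zero on their cup-orthogonal), then for some INTEGRAL `2n`-cycle
`Z` and some `u ≠ 0` the class `[Z]` acts as `u •` (that projector). [VoisinHodgeI2002 §7.3.2, §11.1.4;
FultonYoungTableaux1997 App. B (5); folklore (ℚ-forms of linear systems)] -/
theorem stub_integralProjectorCycle :
    ∀ (n : ℕ) (X : SchemeOver ℂ) (hX : IsSmoothProjective (2 * n) X)
      (ρ : ResolutionFamily (X ⊗ X) (2 * n)), 1 ≤ n →
      ∀ π ∈ Submodule.span ℂ (Set.range (cycleClass complexOrientationFamily
          (IsSmoothProjective.tensor_holds hX hX) (rfl : 2 * n + 2 * n = 2 * n + 2 * n) ρ)),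
        (∀ c : complexBetti X (2 * n), IsRationalClass c → IsOfHodgeType (2 * n) X (2 * n) n n c →
          corrAction complexOrientationFamily hX hX
            (rfl : 2 * n + 2 * (2 * n) = 2 * n + 2 * (2 * n)) π c = c) →
        (∀ b : complexBetti X (2 * n),
          (∀ a : complexBetti X (2 * n), IsRationalClass a → IsOfHodgeType (2 * n) X (2 * n) n n a →
            cupProduct (rfl : 2 * n + 2 * n = 2 * n + 2 * n) a b = 0) →
          corrAction complexOrientationFamily hX hX
            (rfl : 2 * n + 2 * (2 * n) = 2 * n + 2 * (2 * n)) π b = 0) →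
        ∃ (Z : ↥(cyclesOfDim (X ⊗ X).left (2 * n))) (u : ℂ), u ≠ 0 ∧
          (∀ c : complexBetti X (2 * n), IsRationalClass c → IsOfHodgeType (2 * n) X (2 * n) n n c →
            corrAction complexOrientationFamily hX hX
              (rfl : 2 * n + 2 * (2 * n) = 2 * n + 2 * (2 * n))
              (cycleClass complexOrientationFamily (IsSmoothProjective.tensor_holds hX hX)
                (rfl : 2 * n + 2 * n = 2 * n + 2 * n) ρ Z) c = u • c) ∧
          (∀ b : complexBetti X (2 * n),
            (∀ a : complexBetti X (2 * n), IsRationalClass a → IsOfHodgeType (2 * n) X (2 * n) n n a →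
              cupProduct (rfl : 2 * n + 2 * n = 2 * n + 2 * n) a b = 0) →
            corrAction complexOrientationFamily hX hX
              (rfl : 2 * n + 2 * (2 * n) = 2 * n + 2 * (2 * n))
              (cycleClass complexOrientationFamily (IsSmoothProjective.tensor_holds hX hX)
                (rfl : 2 * n + 2 * n = 2 * n + 2 * n) ρ Z) b = 0) := by
  sorry

/-- **STUB H — the heart: homological two-sided Bloch–Srinivas decomposition of an integral
projector cycle, in the middle degree.** For `X` smooth projective of dimension `2n ≥ 2`, a resolution
family `ρ` of `X × X` in dimension `2n`, and an integral `2n`-cycle `Z` on `X × X` whose class acts on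
`H^{2n}(X(ℂ); ℂ)` as `u •` (orthogonal Hodge projector), `u ≠ 0`: there are a proper Zariski-closed
`D ⊊ X`, `2n`-cycles `Z'` (first projection of every point of its support in `D`) and `Z''` (second
projection in `D`) and `m > 0` with `[Z' + Z'']_* = m • [Z]_*` as endomorphisms of `H^{2n}(X(ℂ); ℂ)`.
OPEN (HC-implied: `Z' = Σ (m u gⁱʲ)[Zᵢ × Zⱼ]`, `Z'' = 0`); theorem in the End/Lefschetz sectors.
[BlochSrinivas1983 Prop. 1; VoisinHodgeII2003 Thm. 10.19, Cor. 10.20, (10.7)–(10.9); Voisin2025 §5.2–5.3;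
Kleiman1968; Andre1996Motifs §2.1; arXiv:2502.03415] -/
theorem stub_crossDecomposition :
    ∀ (n : ℕ) (X : SchemeOver ℂ) (hX : IsSmoothProjective (2 * n) X)
      (ρ : ResolutionFamily (X ⊗ X) (2 * n)), 1 ≤ n →
      ∀ (Z : ↥(cyclesOfDim (X ⊗ X).left (2 * n))) (u : ℂ), u ≠ 0 →
        (∀ c : complexBetti X (2 * n), IsRationalClass c → IsOfHodgeType (2 * n) X (2 * n) n n c →
          corrAction complexOrientationFamily hX hX
            (rfl : 2 * n + 2 * (2 * n) = 2 * n + 2 * (2 * n))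
            (cycleClass complexOrientationFamily (IsSmoothProjective.tensor_holds hX hX)
              (rfl : 2 * n + 2 * n = 2 * n + 2 * n) ρ Z) c = u • c) →
        (∀ b : complexBetti X (2 * n),
          (∀ a : complexBetti X (2 * n), IsRationalClass a → IsOfHodgeType (2 * n) X (2 * n) n n a →
            cupProduct (rfl : 2 * n + 2 * n = 2 * n + 2 * n) a b = 0) →
          corrAction complexOrientationFamily hX hX
            (rfl : 2 * n + 2 * (2 * n) = 2 * n + 2 * (2 * n))
            (cycleClass complexOrientationFamily (IsSmoothProjective.tensor_holds hX hX)
              (rfl : 2 * n + 2 * n = 2 * n + 2 * n) ρ Z) b = 0) →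
        ∃ D : Set X.left, IsClosed D ∧ D ≠ Set.univ ∧
          ∃ (Z' Z'' : ↥(cyclesOfDim (X ⊗ X).left (2 * n))) (m : ℕ), 0 < m ∧
            (∀ z, (Z' : AlgebraicCycle (X ⊗ X).left ℤ) z ≠ 0 → (fst X X).left.base z ∈ D) ∧
            (∀ z, (Z'' : AlgebraicCycle (X ⊗ X).left ℤ) z ≠ 0 → (snd X X).left.base z ∈ D) ∧
            ∀ c : complexBetti X (2 * n),
              corrAction complexOrientationFamily hX hX
                  (rfl : 2 * n + 2 * (2 * n) = 2 * n + 2 * (2 * n))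
                  (cycleClass complexOrientationFamily (IsSmoothProjective.tensor_holds hX hX)
                    (rfl : 2 * n + 2 * n = 2 * n + 2 * n) ρ (Z' + Z'')) c =
                (m : ℂ) • corrAction complexOrientationFamily hX hX
                  (rfl : 2 * n + 2 * (2 * n) = 2 * n + 2 * (2 * n))
                  (cycleClass complexOrientationFamily (IsSmoothProjective.tensor_holds hX hX)
                    (rfl : 2 * n + 2 * n = 2 * n + 2 * n) ρ Z) c := by
  sorry

/-! ### Name-keyed statement aliases (the skeleton audit admits a hypothesis of
`HodgeProjectorDivisorSupported_of` iff the head constant of its type has the short name of a declared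
stub) -/
namespace Registered

/-- Statement of `stub_algebraicClasses_le_span_cycleClass`, keyed by the stub name. -/
abbrev stub_algebraicClasses_le_span_cycleClass : Prop :=
  ∀ ⦃n d e : ℕ⦄ ⦃X : SchemeOver ℂ⦄ (hX : IsSmoothProjective n X) (hde : d + e = n)
    (ρ : ResolutionFamily X d),
    algebraicClasses X e ≤
      Submodule.span ℂ (Set.range (cycleClass complexOrientationFamily hX hde ρ))

/-- Statement of `stub_integralProjectorCycle`, keyed by the stub name. -/
abbrev stub_integralProjectorCycle : Prop :=
  ∀ (n : ℕ) (X : SchemeOver ℂ) (hX : IsSmoothProjective (2 * n) X)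
    (ρ : ResolutionFamily (X ⊗ X) (2 * n)), 1 ≤ n →
    ∀ π ∈ Submodule.span ℂ (Set.range (cycleClass complexOrientationFamily
        (IsSmoothProjective.tensor_holds hX hX) (rfl : 2 * n + 2 * n = 2 * n + 2 * n) ρ)),
      (∀ c : complexBetti X (2 * n), IsRationalClass c → IsOfHodgeType (2 * n) X (2 * n) n n c →
        corrAction complexOrientationFamily hX hX
          (rfl : 2 * n + 2 * (2 * n) = 2 * n + 2 * (2 * n)) π c = c) →
      (∀ b : complexBetti X (2 * n),
        (∀ a : complexBetti X (2 * n), IsRationalClass a → IsOfHodgeType (2 * n) X (2 * n) n n a →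
          cupProduct (rfl : 2 * n + 2 * n = 2 * n + 2 * n) a b = 0) →
        corrAction complexOrientationFamily hX hX
          (rfl : 2 * n + 2 * (2 * n) = 2 * n + 2 * (2 * n)) π b = 0) →
      ∃ (Z : ↥(cyclesOfDim (X ⊗ X).left (2 * n))) (u : ℂ), u ≠ 0 ∧
        (∀ c : complexBetti X (2 * n), IsRationalClass c → IsOfHodgeType (2 * n) X (2 * n) n n c →
          corrAction complexOrientationFamily hX hX
            (rfl : 2 * n + 2 * (2 * n) = 2 * n + 2 * (2 * n))
            (cycleClass complexOrientationFamily (IsSmoothProjective.tensor_holds hX hX)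
              (rfl : 2 * n + 2 * n = 2 * n + 2 * n) ρ Z) c = u • c) ∧
        (∀ b : complexBetti X (2 * n),
          (∀ a : complexBetti X (2 * n), IsRationalClass a → IsOfHodgeType (2 * n) X (2 * n) n n a →
            cupProduct (rfl : 2 * n + 2 * n = 2 * n + 2 * n) a b = 0) →
          corrAction complexOrientationFamily hX hX
            (rfl : 2 * n + 2 * (2 * n) = 2 * n + 2 * (2 * n))
            (cycleClass complexOrientationFamily (IsSmoothProjective.tensor_holds hX hX)
              (rfl : 2 * n + 2 * n = 2 * n + 2 * n) ρ Z) b = 0)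

/-- Statement of `stub_crossDecomposition`, keyed by the stub name. -/
abbrev stub_crossDecomposition : Prop :=
  ∀ (n : ℕ) (X : SchemeOver ℂ) (hX : IsSmoothProjective (2 * n) X)
    (ρ : ResolutionFamily (X ⊗ X) (2 * n)), 1 ≤ n →
    ∀ (Z : ↥(cyclesOfDim (X ⊗ X).left (2 * n))) (u : ℂ), u ≠ 0 →
      (∀ c : complexBetti X (2 * n), IsRationalClass c → IsOfHodgeType (2 * n) X (2 * n) n n c →
        corrAction complexOrientationFamily hX hX
          (rfl : 2 * n + 2 * (2 * n) = 2 * n + 2 * (2 * n))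
          (cycleClass complexOrientationFamily (IsSmoothProjective.tensor_holds hX hX)
            (rfl : 2 * n + 2 * n = 2 * n + 2 * n) ρ Z) c = u • c) →
      (∀ b : complexBetti X (2 * n),
        (∀ a : complexBetti X (2 * n), IsRationalClass a → IsOfHodgeType (2 * n) X (2 * n) n n a →
          cupProduct (rfl : 2 * n + 2 * n = 2 * n + 2 * n) a b = 0) →
        corrAction complexOrientationFamily hX hX
          (rfl : 2 * n + 2 * (2 * n) = 2 * n + 2 * (2 * n))
          (cycleClass complexOrientationFamily (IsSmoothProjective.tensor_holds hX hX)
            (rfl : 2 * n + 2 * n = 2 * n + 2 * n) ρ Z) b = 0) →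
      ∃ D : Set X.left, IsClosed D ∧ D ≠ Set.univ ∧
        ∃ (Z' Z'' : ↥(cyclesOfDim (X ⊗ X).left (2 * n))) (m : ℕ), 0 < m ∧
          (∀ z, (Z' : AlgebraicCycle (X ⊗ X).left ℤ) z ≠ 0 → (fst X X).left.base z ∈ D) ∧
          (∀ z, (Z'' : AlgebraicCycle (X ⊗ X).left ℤ) z ≠ 0 → (snd X X).left.base z ∈ D) ∧
          ∀ c : complexBetti X (2 * n),
            corrAction complexOrientationFamily hX hX
                (rfl : 2 * n + 2 * (2 * n) = 2 * n + 2 * (2 * n))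
                (cycleClass complexOrientationFamily (IsSmoothProjective.tensor_holds hX hX)
                  (rfl : 2 * n + 2 * n = 2 * n + 2 * n) ρ (Z' + Z'')) c =
              (m : ℂ) • corrAction complexOrientationFamily hX hX
                (rfl : 2 * n + 2 * (2 * n) = 2 * n + 2 * (2 * n))
                (cycleClass complexOrientationFamily (IsSmoothProjective.tensor_holds hX hX)
                  (rfl : 2 * n + 2 * n = 2 * n + 2 * n) ρ Z) c

end Registered

/-! ## §2 Composition (no `sorry` below this line) -/

/-- **The three stubs imply the crux, BY NAME.** Given `n ≥ 1`, `X`, `hX`, `ρ` and the W2-witness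
`π ∈ N^{2n}H^{4n}(X × X)` acting as the orthogonal Hodge projector: K puts `π` in the `ℂ`-span of cycle
classes, D yields an integral `2n`-cycle `Z` with `[Z]_* = u • P` (`u ≠ 0`), H yields the cross-supported
`Z' + Z''` over a proper closed `D` with `[Z' + Z'']_* = m • [Z]_*` on `H^{2n}` (`m > 0`); then
`[Z' + Z'']_*` is the identity times `u' := m·u ≠ 0` on rational `(n,n)`-classes and zero on their
cup-orthogonal. -/
theorem HodgeProjectorDivisorSupported_of
    (hK : Registered.stub_algebraicClasses_le_span_cycleClass)
    (hD : Registered.stub_integralProjectorCycle)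
    (hH : Registered.stub_crossDecomposition) :
    Summit.HodgeConjecture.HodgeConjecture.Theses.HodgeProjectorDivisorSupport.HodgeProjectorDivisorSupported := by
  intro n X hX ρ hn hπ
  obtain ⟨π, hπalg, hid, hzero⟩ := hπ
  -- K: the algebraic class `π` lies in the span of cycle classes of `2n`-cycles on `X × X`
  have hspan : π ∈ Submodule.span ℂ (Set.range (cycleClass complexOrientationFamily
      (IsSmoothProjective.tensor_holds hX hX) (rfl : 2 * n + 2 * n = 2 * n + 2 * n) ρ)) :=
    hK (IsSmoothProjective.tensor_holds hX hX) (rfl : 2 * n + 2 * n = 2 * n + 2 * n) ρ hπalg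
  -- D: an integral projector cycle `Z`, `[Z]_* = u • P`, `u ≠ 0`
  obtain ⟨Z, u, hu, hZid, hZzero⟩ := hD n X hX ρ hn π hspan hid hzero
  -- H: the two-sided decomposition of `Z` over a proper closed `D`
  obtain ⟨D, hDcl, hDne, Z', Z'', m, hm, hZ'D, hZ''D, hact⟩ := hH n X hX ρ hn Z u hu hZid hZzero
  refine ⟨D, hDcl, hDne, Z', Z'', (m : ℂ) * u, mul_ne_zero (by exact_mod_cast hm.ne') hu, hZ'D, hZ''D,
    fun c hc hh ↦ ?_, fun b hb ↦ ?_⟩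
  · rw [hact c, hZid c hc hh, smul_smul]
  · rw [hact b, hZzero b hb, smul_zero]

/-- Wiring check: the registered stubs feed the composition as stated (definitional unfolding only). -/
example :
    Summit.HodgeConjecture.HodgeConjecture.Theses.HodgeProjectorDivisorSupport.HodgeProjectorDivisorSupported :=
  HodgeProjectorDivisorSupported_of stub_algebraicClasses_le_span_cycleClass stub_integralProjectorCycle
    stub_crossDecomposition

/-! ## §3 Plumbing sanity (proved, no `sorry`): the reverse inclusion of STUB K is a theorem of the tree,
so K is exactly purity `Nᵉ H^{2e} = span of cycle classes`. -/

example {n d e : ℕ} {X : SchemeOver ℂ} (hX : IsSmoothProjective n X) (hde : d + e = n)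
    (ρ : ResolutionFamily X d) :
    Submodule.span ℂ (Set.range (cycleClass complexOrientationFamily hX hde ρ)) ≤ algebraicClasses X e :=
  Submodule.span_le.2 (by rintro _ ⟨Z, rfl⟩; exact cycleClass_mem_algebraicClasses _ hX hde ρ Z)

end Summit.HodgeConjecture.HodgeConjecture.Cruxes.HodgeProjectorDivisorSupported.Birth
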